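import Mathlib.Analysis.MeanInequalities
import Mathlib.Data.Matrix.Mul
import Literature.MathematicalPhysics.QuantumFieldTheory.Balaban1983to89.B9CubeCoarsening

/-!
# `Balaban1983to89.B9L2BlockSchurCoarsening` — `L²` BLOCK BOUNDS PASS FROM A FINE BLOCK PARTITION TO A COARSER ONE (Schur's test over
# sub-blocks): the operator-generic coarsening-transfer lemma for the `L²` members of [B9] (3.46) ∕ [4] (2.67) between two nested block
# families (e.g. the cube sequence `{Ω_n(□)}` of p. 408 inside the member `{Ω_j}`), NO equation of the operator used
# (sub-row G-B9-LETTERS; lead g30 RULING #6 (c))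

FRAMING (verbatim cell line):
statement-level skeleton of published theorems with citation tags; proofs where landed; nothing here is a claim about the Yang–Mills mass gap

Sources under audit (cell lit-balaban): T. Bałaban, *Propagators for lattice gauge theories in a background field*, Commun. Math. Phys. **99**
(1985) 389–434 [`Balaban1985BackgroundPropagators`, "B9"], (3.46) p. 398 («Finally, we have the inequalities in L²-norms ‖hG′(U)λ‖, … ≦
B₀[(Lʲη)², Lʲη, Lʲη, 1, 1, 1]|h|e^{−δ₀d(y,y′)}‖λ‖ for supp h ⊂ Δ(y), y ∈ Λ_j, supp λ ⊂ Δ(y′)»), p. 409 l. 3–5 (the operators of the cube sequence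
«satisfy all the inequalities of Theorems 3.1–3.3 correspondingly»), p. 408 (the cube sequence `{Ω_n(□)}`, «This sequence satisfies the conditions
(2.1), (2.2) with j instead of k»); T. Bałaban, *Propagators and renormalization transformations for lattice gauge theories. II*, Commun. Math.
Phys. **96** (1984) 223–250 [`Balaban1984PropagatorsII`, "[4]"], (2.45)–(2.46) p. 231 (blocks `𝔅`, the distance), (2.51)–(2.55) p. 232 (block
majorants compose; «where Δ(y) = Bʲ(y) if y ∈ Λ_j»), Prop. 2.2 (2.67) p. 234.  Unit `lit-balaban-r05` (r05 gen 80).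

## WHY (the gap this glue fills)

Print states every inequality of Theorems 3.1–3.3 for the cube-sequence operators `G′_□, C_□, G_□` «correspondingly» (p. 409), i.e. in the blocks
of the CUBE SEQUENCE, and then USES them against the member's blocks `Δ(y)` (e.g. (3.89), (3.105)).  For the sup-norm (kernel) members the passage
fine blocks → member blocks is `B9CubeCoarsening` ∕ `B9CubeCoarseningGlobal` (r05 g77: a majorant over the cube sequence's geometry is a majorant
over the member's, `coarsen`, `dist_coarsen_le`).  For the `L²` members ((3.46)) a block bound does NOT pass to a union of blocks for free: the
`L²(B(y′)) → L²(B(y))` norm of `T` between two MEMBER blocks is controlled by the matrix of its norms between their SUB-BLOCKS through Schur's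
test.  This file is that step, operator-generically: no equation, no geometry — any matrix `T`, any fine block map `bF : X → YF`, any coarsening
`π : YF → YD`.

## WHAT THIS FILE CERTIFIES (theorems only; kernel-checked)

§1 (generic, finite index types) `sum_mul_le_sqrt_mul_sqrt` (Cauchy–Schwarz), `sum_sq_sum_le` (Minkowski: `Σ_x(Σ_j f_j(x))² ≤ (Σ_j‖f_j‖₂)²`),
`sq_sum_mul_le` (weighted Cauchy–Schwarz `(Σ a m)² ≤ (Σ a)(Σ a m²)`, `a ≥ 0`), ★★ `l2_coarse_block_sq_le` — **THE COARSENING TRANSFER**: if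
`Σ_{x∈s}((Tμ)(x))² ≤ a(s,s′)²·Σμ²` for every pair of fine blocks `s, s′` and every `μ` supported in `s′`, then for coarse blocks `y, y′` and
`λ` supported in the union of the fine blocks of `y′`:
`Σ_{x : π(bF x) = y}((Tλ)(x))² ≤ R·C·Σλ²`, `R = max_{s ⊂ y} Σ_{s′ ⊂ y′} a(s,s′)`, `C = max_{s′ ⊂ y′} Σ_{s ⊂ y} a(s,s′)` (Schur over sub-blocks).
§2 (the cube sequence inside the member, `B9CubeCoarsening.coarsen`) ★ `l2_member_block_sq_le_of_cube_blocks` — the same with `bF :=` the cube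
family's block map, `π := coarsen` (`coarsen ∘ blkOf_□ = blkOf`, `coarsen_blkOf`): `L²` bounds of ANY `T` between cube-sequence blocks give
`L²` bounds between member blocks.

## HONEST SCOPE

* Pure finite-dimensional linear algebra; nothing of [B9] or [4] is asserted; the exponential bookkeeping `Σ_{s′⊂y′} e^{−δd_□(s,s′)} ≤ …` that turns
  `R·C` into `C′e^{−δ′d(y,y′)}` is geometry (`B9CubeCoarsening.dist_coarsen_le`, [4] (2.48)) and is NOT done here; no consumer of record today
  (lead g30 RULING #6: (O3)′ skipped — this is the reusable glue for the day it re-opens).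
* Nothing is inferred from the manuscript; kernel-checked; 0 definitions, 0 facts.  NOT summit progress; the YM mass gap is not proved by any of this.
-/

namespace Literature.MathematicalPhysics.QuantumFieldTheory.Balaban1983to89.B9L2BlockSchurCoarsening

open Finset
open scoped Matrix

noncomputable section

/-! ## §1 Generic: Cauchy–Schwarz, Minkowski, weighted Cauchy–Schwarz, the block-Schur coarsening transfer -/

section Generic

variable {ι κ : Type*}

/-- Cauchy–Schwarz with square roots: `Σ f g ≤ ‖f‖₂‖g‖₂`. [folklore] [cite: Balaban1984PropagatorsII, (2.67) p.234 (the L² reading of (3.46)), bookkeeping] -/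
theorem sum_mul_le_sqrt_mul_sqrt (s : Finset ι) (f g : ι → ℝ) :
    ∑ i ∈ s, f i * g i ≤ √(∑ i ∈ s, f i ^ 2) * √(∑ i ∈ s, g i ^ 2) := by
  have h := Finset.sum_mul_sq_le_sq_mul_sq s f g
  have h1 : |∑ i ∈ s, f i * g i| ≤ √((∑ i ∈ s, f i ^ 2) * ∑ i ∈ s, g i ^ 2) := Real.abs_le_sqrt h
  rw [Real.sqrt_mul (Finset.sum_nonneg fun i _ => sq_nonneg (f i))] at h1
  exact (le_abs_self _).trans h1

/-- **MINKOWSKI** (finite sums): `Σ_x (Σ_j f_j(x))² ≤ (Σ_j √(Σ_x f_j(x)²))²`. [folklore] [cite: Balaban1985BackgroundPropagators, (3.46) p.398, bookkeeping] -/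
theorem sum_sq_sum_le (s : Finset ι) (t : Finset κ) (f : κ → ι → ℝ) :
    ∑ x ∈ s, (∑ j ∈ t, f j x) ^ 2 ≤ (∑ j ∈ t, √(∑ x ∈ s, f j x ^ 2)) ^ 2 := by
  calc ∑ x ∈ s, (∑ j ∈ t, f j x) ^ 2
      = ∑ x ∈ s, ∑ j ∈ t, ∑ j' ∈ t, f j x * f j' x := by
        refine Finset.sum_congr rfl fun x _ => ?_
        rw [sq, Finset.sum_mul_sum]
    _ = ∑ j ∈ t, ∑ j' ∈ t, ∑ x ∈ s, f j x * f j' x := by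
        rw [Finset.sum_comm]
        refine Finset.sum_congr rfl fun j _ => ?_
        rw [Finset.sum_comm]
    _ ≤ ∑ j ∈ t, ∑ j' ∈ t, √(∑ x ∈ s, f j x ^ 2) * √(∑ x ∈ s, f j' x ^ 2) :=
        Finset.sum_le_sum fun j _ => Finset.sum_le_sum fun j' _ => sum_mul_le_sqrt_mul_sqrt s (f j) (f j')
    _ = (∑ j ∈ t, √(∑ x ∈ s, f j x ^ 2)) ^ 2 := by rw [sq, Finset.sum_mul_sum]

/-- **WEIGHTED CAUCHY–SCHWARZ** (the squared Schur step): `(Σ_j a_j m_j)² ≤ (Σ_j a_j)·(Σ_j a_j m_j²)` for `a ≥ 0`. [folklore] [cite: Balaban1984PropagatorsII, (2.52)–(2.55) p.232, bookkeeping] -/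
theorem sq_sum_mul_le (t : Finset κ) (a m : κ → ℝ) (ha : ∀ j ∈ t, 0 ≤ a j) :
    (∑ j ∈ t, a j * m j) ^ 2 ≤ (∑ j ∈ t, a j) * ∑ j ∈ t, a j * m j ^ 2 := by
  have h := Finset.sum_mul_sq_le_sq_mul_sq t (fun j => √(a j)) (fun j => √(a j) * m j)
  have e1 : ∀ j ∈ t, √(a j) * (√(a j) * m j) = a j * m j := fun j hj => by
    rw [← mul_assoc, Real.mul_self_sqrt (ha j hj)]
  have e2 : ∀ j ∈ t, √(a j) ^ 2 = a j := fun j hj => by rw [sq, Real.mul_self_sqrt (ha j hj)]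
  have e3 : ∀ j ∈ t, (√(a j) * m j) ^ 2 = a j * m j ^ 2 := fun j hj => by
    rw [mul_pow, sq (√(a j)), Real.mul_self_sqrt (ha j hj)]
  rw [Finset.sum_congr rfl e1, Finset.sum_congr rfl e2, Finset.sum_congr rfl e3] at h
  exact h

variable {X YF YD : Type*} [Fintype X] [Fintype YF] [DecidableEq YF] [DecidableEq YD]

/-- ★★ **THE `L²` COARSENING TRANSFER (Schur's test over sub-blocks).**  Fine blocks `bF : X → YF` refine coarse blocks through `π : YF → YD`.
If the matrix `T` satisfies the fine `L²` block bounds `Σ_{x∈s}((Tμ)(x))² ≤ a(s,s′)²·Σμ²` (`μ` supported in the fine block `s′`), and on the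
sub-blocks of two coarse blocks `y, y′` the rows and columns of `a` sum to at most `R` and `C`, then for `λ` supported in (the fine blocks of) `y′`:
`Σ_{x : π(bF x) = y}((Tλ)(x))² ≤ R·C·Σλ²`.  No property of `T` beyond the fine bounds is used.
[cite: Balaban1985BackgroundPropagators, (3.46) p.398 with p.409 l.3–5; Balaban1984PropagatorsII, (2.52)–(2.55) p.232, (2.67) p.234] -/
theorem l2_coarse_block_sq_le (T : Matrix X X ℝ) (bF : X → YF) (π : YF → YD) (a : YF → YF → ℝ)
    (ha : ∀ s s', 0 ≤ a s s')
    (hT : ∀ (s s' : YF) (μ : X → ℝ), (∀ z, bF z ≠ s' → μ z = 0) →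
      ∑ x ∈ univ.filter (fun x => bF x = s), ((T *ᵥ μ) x) ^ 2 ≤ a s s' ^ 2 * ∑ z, μ z ^ 2)
    (y y' : YD) {R C : ℝ} (hR0 : 0 ≤ R)
    (hR : ∀ s, π s = y → ∑ s' ∈ univ.filter (fun s' => π s' = y'), a s s' ≤ R)
    (hC : ∀ s', π s' = y' → ∑ s ∈ univ.filter (fun s => π s = y), a s s' ≤ C)
    (lam : X → ℝ) (hlam : ∀ z, π (bF z) ≠ y' → lam z = 0) :
    ∑ x ∈ univ.filter (fun x => π (bF x) = y), ((T *ᵥ lam) x) ^ 2 ≤ R * C * ∑ z, lam z ^ 2 := by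
  classical
  set S : Finset YF := univ.filter (fun s : YF => π s = y) with hS
  set S' : Finset YF := univ.filter (fun s' : YF => π s' = y') with hS'
  -- the pieces of `λ` on the fine blocks of `y′`
  set piece : YF → X → ℝ := fun s' z => if bF z = s' then lam z else 0 with hpiece
  have hpiece_supp : ∀ s' z, bF z ≠ s' → piece s' z = 0 := fun s' z hz => by
    simp only [hpiece, if_neg hz]
  have hpiece_self : ∀ z, piece (bF z) z = lam z := fun z => by simp [hpiece]
  have hpiece_ne : ∀ s' z, s' ≠ bF z → piece s' z = 0 := fun s' z h => hpiece_supp s' z (Ne.symm h)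
  have hsum : lam = ∑ s' ∈ S', piece s' := by
    funext z
    rw [Finset.sum_apply]
    by_cases hz : π (bF z) = y'
    · rw [Finset.sum_eq_single (bF z) (fun s' _ hs' => hpiece_ne s' z hs')
        (fun h => absurd (show bF z ∈ S' from Finset.mem_filter.2 ⟨Finset.mem_univ _, hz⟩) h), hpiece_self]
    · rw [hlam z hz]
      symm
      refine Finset.sum_eq_zero fun s' hs' => ?_
      have hne : bF z ≠ s' := fun h => hz (by rw [h]; exact (Finset.mem_filter.1 hs').2)
      exact hpiece_supp s' z hne
  -- `Σ_{s′} ‖piece s′‖² = ‖λ‖²`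
  have hm : ∑ s' ∈ S', ∑ z, piece s' z ^ 2 = ∑ z, lam z ^ 2 := by
    rw [Finset.sum_comm]
    refine Finset.sum_congr rfl fun z _ => ?_
    by_cases hz : π (bF z) = y'
    · rw [Finset.sum_eq_single (bF z) (fun s' _ hs' => by rw [hpiece_ne s' z hs']; ring)
        (fun h => absurd (show bF z ∈ S' from Finset.mem_filter.2 ⟨Finset.mem_univ _, hz⟩) h), hpiece_self]
    · rw [hlam z hz]
      have : ∀ s' ∈ S', piece s' z ^ 2 = 0 := fun s' hs' => by
        have hne : bF z ≠ s' := fun h => hz (by rw [h]; exact (Finset.mem_filter.1 hs').2)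
        rw [hpiece_supp s' z hne]; ring
      rw [Finset.sum_congr rfl this]; simp
  -- `Tλ = Σ_{s′} T(piece s′)`
  have hT_sum : T *ᵥ lam = ∑ s' ∈ S', T *ᵥ piece s' := by rw [hsum, Matrix.mulVec_sum]
  -- one fine row block `s ⊂ y`
  have hrow : ∀ s ∈ S, ∑ x ∈ univ.filter (fun x => bF x = s), ((T *ᵥ lam) x) ^ 2
      ≤ R * ∑ s' ∈ S', a s s' * ∑ z, piece s' z ^ 2 := by
    intro s hs
    have hsy : π s = y := (Finset.mem_filter.1 hs).2
    -- Minkowski over the pieces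
    have h1 : ∑ x ∈ univ.filter (fun x => bF x = s), ((T *ᵥ lam) x) ^ 2
        ≤ (∑ s' ∈ S', √(∑ x ∈ univ.filter (fun x => bF x = s), ((T *ᵥ piece s') x) ^ 2)) ^ 2 := by
      have h := sum_sq_sum_le (univ.filter (fun x => bF x = s)) S' (fun s' x => (T *ᵥ piece s') x)
      rw [hT_sum]
      simpa only [Finset.sum_apply] using h
    -- each piece through the fine bound
    have h2 : ∀ s' ∈ S', √(∑ x ∈ univ.filter (fun x => bF x = s), ((T *ᵥ piece s') x) ^ 2)
        ≤ a s s' * √(∑ z, piece s' z ^ 2) := by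
      intro s' _
      have h := hT s s' (piece s') (hpiece_supp s')
      calc √(∑ x ∈ univ.filter (fun x => bF x = s), ((T *ᵥ piece s') x) ^ 2)
          ≤ √(a s s' ^ 2 * ∑ z, piece s' z ^ 2) := Real.sqrt_le_sqrt h
        _ = a s s' * √(∑ z, piece s' z ^ 2) := by rw [Real.sqrt_mul (sq_nonneg _), Real.sqrt_sq (ha s s')]
    have h3 : (∑ s' ∈ S', √(∑ x ∈ univ.filter (fun x => bF x = s), ((T *ᵥ piece s') x) ^ 2)) ^ 2
        ≤ (∑ s' ∈ S', a s s' * √(∑ z, piece s' z ^ 2)) ^ 2 := by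
      have hle := Finset.sum_le_sum h2
      have h0 : 0 ≤ ∑ s' ∈ S', √(∑ x ∈ univ.filter (fun x => bF x = s), ((T *ᵥ piece s') x) ^ 2) :=
        Finset.sum_nonneg fun _ _ => Real.sqrt_nonneg _
      exact pow_le_pow_left₀ h0 hle 2
    -- weighted Cauchy–Schwarz and the row sum
    have h4 := sq_sum_mul_le S' (fun s' => a s s') (fun s' => √(∑ z, piece s' z ^ 2)) (fun s' _ => ha s s')
    have h5 : ∑ s' ∈ S', a s s' * √(∑ z, piece s' z ^ 2) ^ 2 = ∑ s' ∈ S', a s s' * ∑ z, piece s' z ^ 2 :=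
      Finset.sum_congr rfl fun s' _ => by rw [Real.sq_sqrt (Finset.sum_nonneg fun z _ => sq_nonneg _)]
    rw [h5] at h4
    have hnn : 0 ≤ ∑ s' ∈ S', a s s' * ∑ z, piece s' z ^ 2 :=
      Finset.sum_nonneg fun s' _ => mul_nonneg (ha s s') (Finset.sum_nonneg fun z _ => sq_nonneg _)
    have h6 : (∑ s' ∈ S', a s s') * ∑ s' ∈ S', a s s' * ∑ z, piece s' z ^ 2
        ≤ R * ∑ s' ∈ S', a s s' * ∑ z, piece s' z ^ 2 := mul_le_mul_of_nonneg_right (hR s hsy) hnn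
    exact h1.trans (h3.trans (h4.trans h6))
  -- regroup the coarse row block into its fine blocks and sum
  have hregroup : ∑ x ∈ univ.filter (fun x => π (bF x) = y), ((T *ᵥ lam) x) ^ 2
      = ∑ s ∈ S, ∑ x ∈ univ.filter (fun x => bF x = s), ((T *ᵥ lam) x) ^ 2 := by
    rw [Finset.sum_fiberwise_eq_sum_filter univ S bF (fun x => ((T *ᵥ lam) x) ^ 2)]
    refine Finset.sum_congr ?_ fun _ _ => rfl
    ext x
    simp [hS]
  rw [hregroup]
  calc ∑ s ∈ S, ∑ x ∈ univ.filter (fun x => bF x = s), ((T *ᵥ lam) x) ^ 2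
      ≤ ∑ s ∈ S, R * ∑ s' ∈ S', a s s' * ∑ z, piece s' z ^ 2 := Finset.sum_le_sum hrow
    _ = R * ∑ s' ∈ S', (∑ s ∈ S, a s s') * ∑ z, piece s' z ^ 2 := by
        rw [← Finset.mul_sum, Finset.sum_comm]
        congr 1
        refine Finset.sum_congr rfl fun s' _ => ?_
        rw [Finset.sum_mul]
    _ ≤ R * ∑ s' ∈ S', C * ∑ z, piece s' z ^ 2 := by
        refine mul_le_mul_of_nonneg_left (Finset.sum_le_sum fun s' hs' => ?_) hR0
        exact mul_le_mul_of_nonneg_right (hC s' (Finset.mem_filter.1 hs').2) (Finset.sum_nonneg fun z _ => sq_nonneg _)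
    _ = R * C * ∑ z, lam z ^ 2 := by rw [← Finset.mul_sum, hm, mul_assoc]

end Generic

/-! ## §2 The cube sequence inside the member: `L²` bounds between cube-sequence blocks give `L²` bounds between member blocks -/

section Cube

open Literature.MathematicalPhysics.QuantumFieldTheory.Balaban1983to89.B4Reflection242 (boxDom)
open Literature.MathematicalPhysics.QuantumFieldTheory.Balaban1983to89.B6MultiLevelBoxOperator (N0)
open Literature.MathematicalPhysics.QuantumFieldTheory.Balaban1983to89.B6Cover236MultiLevelBlocks (cubes)
open Literature.MathematicalPhysics.QuantumFieldTheory.Balaban1983to89.B6Geom246MultiLevelBox (bset blkOf)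
open Literature.MathematicalPhysics.QuantumFieldTheory.Balaban1983to89.B9CubeSequence408 (cubeFam)
open Literature.MathematicalPhysics.QuantumFieldTheory.Balaban1983to89.B9CubeCoarsening (coarsen coarsen_blkOf)

variable {d ℓ Mh k R : ℕ} {P : Fin (d + 1) → ℕ} {D : B6MultiLevelTorusOperator.TDomains d ℓ Mh k P R} {q : ↥(cubes D.toDomains)}
  {hL : Odd (ℓ + 1)} {hM : Odd Mh} {hMh : 1 ≤ Mh} {hP : ∀ μ, 1 ≤ P μ}

/-- ★ **`L²` BOUNDS OF ANY `T` BETWEEN THE CUBE SEQUENCE'S BLOCKS GIVE `L²` BOUNDS BETWEEN THE MEMBER'S BLOCKS** (§1 with `bF :=` the cube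
family's block map and `π := coarsen`, `coarsen ∘ blkOf_□ = blkOf`): if `Σ_{x∈c}((Tμ)(x))² ≤ a(c,c′)²·Σμ²` for all blocks `c, c′` of the cube
sequence `{Ω_n(□)}` and `μ` supported in `c′`, then for member blocks `y, y′` and `λ` supported in `B(y′)`:
`Σ_{x∈B(y)}((Tλ)(x))² ≤ R·C·Σλ²` with `R, C` the row ∕ column sums of `a` over the cube blocks inside `B(y)`, `B(y′)` — the shape of p21's
`B9Ineq346GpFlatMultiLevelTorus.l2_block_sq_le` conclusion, i.e. the (3.46)-member currency of the lineage.
[cite: Balaban1985BackgroundPropagators, (3.46) p.398, p.409 l.3–5 («satisfy all the inequalities of Theorems 3.1–3.3 correspondingly»), p.408; Balaban1984PropagatorsII, (2.45) p.231, (2.52)–(2.55) p.232] -/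
theorem l2_member_block_sq_le_of_cube_blocks (T : Matrix ↥(boxDom (N0 ℓ Mh k P)) ↥(boxDom (N0 ℓ Mh k P)) ℝ)
    (a : ↥(B6Geom246MultiLevelBoxL0.bset (cubeFam D q hL hM hMh hP).toDomains) →
      ↥(B6Geom246MultiLevelBoxL0.bset (cubeFam D q hL hM hMh hP).toDomains) → ℝ)
    (ha : ∀ c c', 0 ≤ a c c')
    (hT : ∀ c c' (μ : ↥(boxDom (N0 ℓ Mh k P)) → ℝ),
      (∀ z, B6Geom246MultiLevelBoxL0.blkOf (cubeFam D q hL hM hMh hP).toDomains z ≠ c' → μ z = 0) →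
      ∑ x ∈ univ.filter (fun x => B6Geom246MultiLevelBoxL0.blkOf (cubeFam D q hL hM hMh hP).toDomains x = c), ((T *ᵥ μ) x) ^ 2
        ≤ a c c' ^ 2 * ∑ z, μ z ^ 2)
    (y y' : ↥(bset D.toDomains)) {R C : ℝ} (hR0 : 0 ≤ R)
    (hR : ∀ c, coarsen c = y → ∑ c' ∈ univ.filter (fun c' => coarsen (q := q) (hL := hL) (hM := hM) (hMh := hMh) (hP := hP) c' = y'), a c c' ≤ R)
    (hC : ∀ c', coarsen c' = y' → ∑ c ∈ univ.filter (fun c => coarsen (q := q) (hL := hL) (hM := hM) (hMh := hMh) (hP := hP) c = y), a c c' ≤ C)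
    (lam : ↥(boxDom (N0 ℓ Mh k P)) → ℝ) (hlam : ∀ z, blkOf D.toDomains z ≠ y' → lam z = 0) :
    ∑ x ∈ univ.filter (fun x => blkOf D.toDomains x = y), ((T *ᵥ lam) x) ^ 2 ≤ R * C * ∑ z, lam z ^ 2 := by
  classical
  have key := l2_coarse_block_sq_le T (B6Geom246MultiLevelBoxL0.blkOf (cubeFam D q hL hM hMh hP).toDomains)
    (coarsen (D := D) (q := q) (hL := hL) (hM := hM) (hMh := hMh) (hP := hP)) a ha hT y y' hR0 hR hC lam
    (fun z hz => hlam z (by rwa [coarsen_blkOf] at hz))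
  have hfilter : univ.filter (fun x : ↥(boxDom (N0 ℓ Mh k P)) =>
      coarsen (B6Geom246MultiLevelBoxL0.blkOf (cubeFam D q hL hM hMh hP).toDomains x) = y)
      = univ.filter (fun x => blkOf D.toDomains x = y) := by
    ext x
    simp only [Finset.mem_filter, Finset.mem_univ, true_and, coarsen_blkOf]
  rw [hfilter] at key
  exact key

end Cube

end

end Literature.MathematicalPhysics.QuantumFieldTheory.Balaban1983to89.B9L2BlockSchurCoarsening
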